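import Summits.BirchSwinnertonDyer.BirchSwinnertonDyer.Theorems.ByReductionTypeAtTwoSupersingularConjATwoGoodSSRowStampsA
import HarnessLib

/-!
# Route `ByReductionTypeAtTwo` (rung K4), crux `SupersingularRankZeroAtTwo` (item stmt-BirchSwinnertonDyer-19097), v2.12 (α) `FineMuZeroOnHabitatAtTwo`:
# GOOD-SUPERSINGULAR ROW STAMPS, part B — `Rank1Residual.FineMuZeroAt (M ⊗ ℚ) 2` / Coates–Sujatha (A)₂ for habitat rows `99d1` … `171d1` (rows 11–20 of the habitat by conductor) by conductor
# (Cremona minimal models `M`), each modulo print `hLim2` and — unless the kernel decides it — ONE displayed parity bit «`2 ∤ h(L_W)`»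
# (a `--supports 19097` file; seat `bsd-2adic-t42` GEN 43, hand h12 «D84 ROW-CERTIFICATE TYPING», director (810)(B) HAND 1; door `…GoodSSDoor`)

HONEST LABEL (cell `bsd-2adic`, D-0036/D-0054): «row certificates mod print (Lim 2017 Thm 3.5); (α) is class-wide and NOT discharged; CDC_H closed
MOD PRINT hPT; BSD proved for no curve». Per-row stamps only: they are BC5-type witnesses / honesty data for the registry's (α) binder
`∀ W [IsElliptic] [IsGloballyMinimal], ¬CM → r_an = 0 → GoodSS W 2 → Rank1Residual.FineMuZeroAt W 2` and do not discharge its `∀`; nothing booked.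
`IsGloballyMinimal` / `GoodSS` / `r_an = 0` / non-CM of the rows are NOT claimed here; for the rows that are UNIT ANCHORS of seat ss-1x (`…SupersingularUnitAnchorsA/C/D`)
the tree's `SSUnitAnchor.isElliptic_ua…` instance is REUSED (dedup) and `isGloballyMinimal_ua…` / `goodSS_two_ua…` decide the first two on the same `M ⊗ ℚ`.

THE HABITAT (crux 19097): non-CM, `r_an = 0`, good SUPERSINGULAR at `2` (`N` odd, `a₂(E) ∈ {0, ±2}`). Census of this hand (kit j343820, one batched PARI job
over Cremona `allcurves.00000-09999`): the 104 habitat isogeny classes with `N ≤ 600` (curve `1` of each class) all have `a₁ = 0, a₃ = 1`; their `2`-division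
cubic fields `L_W = ℚ(x(P))` (`2 = 𝔮³` always, Eisenstein) have ODD class number in 103/104 cases (`h ∈ {1, 3}`; the exception `571a1`: `d = −2284`, `h = 2`,
a layer-≥ 1 row of census2 j305417 — recorded in the cell memo `t42/D84-ROWS-GEN43.md`, not stamped). MECHANISM: `…GoodSSDoor` (the `2`-torsion point
`(β/4, −1/2)`, `β = 4x(P)` a root of `X³ + 4a₂X² + 16a₄X + (64a₆ + 16)`; `π = β/2` root of the Eisenstein cubic `Y³ + 2a₂Y² + 4a₄Y + (8a₆ + 2)`).

THIS PART (B): 10 rows — KERNEL bit (modulo `hLim2` ALONE, generator swap to a class-number-one field decided by the kernel: `d ∈ {−44, −76, −108, −780}`): `99d1`, `121d1`, `135b1`, `171c1`, `171d1`; DISPLAYED bit (`2 ∤ #Cl(𝓞 ℚ(β))`, census value in the docstring): `115a1`, `141e1`, `147b1`, `147c1`, `153d1`. The kernel class-number lemmas are §0 of part A.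

References: [Lim2017FineSelmer] Thm. 3.5, Lemma 3.2; [CoatesSujatha2005] (A); [Greenberg2001IwasawaPastPresent] Prop. 2.1 p. 339; [Cohen1993] App. B
Table B.4; [Marcus1977] Ch. 5; [CremonaAlgorithms1997] Table 1 (`allcurves`/`allbsd`); kit j343820 (`t42/gen43/h12rows.gp`, PARI 2.15: polredabs, bnfinit, bnfcertify).
-/

set_option autoImplicit false
-- sibling precedent (`…GoodSSDoor.lean`): the directory name repeats the summit name
set_option linter.dupNamespace false

noncomputable section

open scoped Classical IntermediateField NumberField

namespace Summit.BirchSwinnertonDyer.BirchSwinnertonDyer.Theorems.AddKatoTwo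

open WeierstrassCurve Field Polynomial IsDedekindDomain Literature.NumberTheory.EllipticCurves
  Literature.NumberTheory.GaloisRepresentations Literature.NumberTheory.IwasawaTheory
  Summit.BirchSwinnertonDyer.BirchSwinnertonDyer.Theorems.AlignedTransportAtTwoTorsionPointField
  Summit.BirchSwinnertonDyer.BirchSwinnertonDyer.Theses.ByReductionTypeAtTwo

/-! ## Rows 11–20 -/

/-! ### Row `99d1` = `[0, 0, 1, -3, -5]` (`a₂(E) = 2`; `L_W`: `x³ − x² + x + 1`, `d = −44`, `h = 1`) -/

-- `IsElliptic` for `99d1 ⊗ ℚ` is the tree's `SSUnitAnchor.isElliptic_ua99d1` (reused, not restated).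

/-- **(A)₂ for `99d1` modulo Lim 2017 Thm. 3.5 (`hLim2`) ALONE — NO displayed datum.** Generator swap: `θ = (11/9) + (1/18)·β + (-1/36)·β²` is a root of `g = X³ − X² + X + 1` (`d = −44`) and `β = (4) + (-6)·θ + (6)·θ²`, so `ℚ(P) = ℚ(β) = ℚ(θ)`; `2 ∤ #Cl(𝓞 ℚ(θ))` BY THE KERNEL (|disc g| = 44 ≤ 45, `…CubicDiscriminant.not_two_dvd_card_classGroup_adjoin_of_abs_discr_le`). Row data (Cremona `allcurves`/`allbsd`): minimal model `[0,0,1,-3,-5]`, `N = 99`, `a₂(E) = 2` (good supersingular at `2`), `r = 0`, `#tors = 1`, non-CM; `2`-division cubic of `β = 4x(P)`: `X³ − 48X − 304`; Eisenstein cubic of `π = 2x(P)`: `Y³ − 12Y − 38`; `L_W = ℚ(β) ≅ ℚ[x]/(x³ − x² + x + 1)`, complex cubic (Δ_E < 0), `d(L_W) = −44`, `h(L_W) = 1` (kit j343820: polredabs/bnfinit, `bnfcertify = 1`). [cite: Lim2017FineSelmer, §3 Thm. 3.5 and Lemma 3.2] [cite: CoatesSujatha2005, §3 statement (A)] -/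
theorem conjA_two_99d1
    (hLim2 : Lim2017.thm35_at_two_fineSelmerDual_moduleFinite_of_classicalMuVanishes_of_le_divisionField_four)
    (κ : ZpExtension ℚ 2) (hκ : κ.IsCyclotomic) :
    haveI := SSUnitAnchor.isElliptic_ua99d1
    ∃ (γ : absoluteGaloisGroup ℚ) (D : ((⟨0, 0, 1, -3, -5⟩ : WeierstrassCurve ℤ).baseChange ℚ).FineSelmerDualData κ γ),
      Module.Finite ℤ_[2] (RestrictScalars ℤ_[2] (IwasawaAlgebra 2) D.X) := by
  haveI := SSUnitAnchor.isElliptic_ua99d1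
  refine conjA_two_goodSSModel_of_generator hLim2 (0) (-3) (-5) (-1) (1) (1) (11/9) (1/18) (-1/36) (4) (-6) (6)
    (fun β θ hβ hθ ↦ ?_) (fun θ hθ ↦ not_two_dvd_card_classGroup_twoDivField_d44n hθ) κ hκ
  subst hθ; push_cast at hβ ⊢
  exact ⟨by linear_combination (((-49 : AlgebraicClosure ℚ) / 5832) + ((1 : AlgebraicClosure ℚ) / 1296) * β + ((1 : AlgebraicClosure ℚ) / 7776) * β ^ 2 + ((-1 : AlgebraicClosure ℚ) / 46656) * β ^ 3) * hβ,
    by linear_combination (-1 : AlgebraicClosure ℚ) * (((-1 : AlgebraicClosure ℚ) / 54) + ((1 : AlgebraicClosure ℚ) / 216) * β) * hβ⟩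

/-- **`FineMuZeroAt (99d1 ⊗ ℚ) 2` modulo `hLim2` ALONE** (kernel bit via the `d = −44` generator swap). [cite: Lim2017FineSelmer, §3 Thm. 3.5 and Lemma 3.2] [cite: CoatesSujatha2005, §3 statement (A)] -/
theorem fineMuZeroAt_two_99d1
    (hLim2 : Lim2017.thm35_at_two_fineSelmerDual_moduleFinite_of_classicalMuVanishes_of_le_divisionField_four) :
    haveI := SSUnitAnchor.isElliptic_ua99d1
    Literature.NumberTheory.EllipticCurves.Rank1Residual.FineMuZeroAt ((⟨0, 0, 1, -3, -5⟩ : WeierstrassCurve ℤ).baseChange ℚ) 2 :=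
  haveI := SSUnitAnchor.isElliptic_ua99d1
  Literature.NumberTheory.EllipticCurves.Rank1Residual.ConjAAt.fineMuZeroAt (conjA_two_99d1 hLim2)

/-! ### Row `115a1` = `[0, 0, 1, 7, -11]` (`a₂(E) = 2`; `L_W`: `x³ − x² + 5x − 3`, `d = −460`, `h = 1`) -/

-- `IsElliptic` for `115a1 ⊗ ℚ` is the tree's `SSUnitAnchor.isElliptic_ua115a1` (reused, not restated).

/-- **(A)₂ for `115a1` modulo Lim 2017 Thm. 3.5 (`hLim2`) + ONE displayed bit `2 ∤ #Cl(𝓞 ℚ(β))`** (census value: `h(L_W) = 1`, `d(L_W) = −460` — PARI, not kernel). Row data (Cremona `allcurves`/`allbsd`): minimal model `[0,0,1,7,-11]`, `N = 115`, `a₂(E) = 2` (good supersingular at `2`), `r = 0`, `#tors = 1`, non-CM; `2`-division cubic of `β = 4x(P)`: `X³ + 112X − 688`; Eisenstein cubic of `π = 2x(P)`: `Y³ + 28Y − 86`; `L_W = ℚ(β) ≅ ℚ[x]/(x³ − x² + 5x − 3)`, complex cubic (Δ_E < 0), `d(L_W) = −460`, `h(L_W) = 1` (kit j343820: polredabs/bnfinit,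 `bnfcertify = 1`). [cite: Lim2017FineSelmer, §3 Thm. 3.5 and Lemma 3.2] [cite: CoatesSujatha2005, §3 statement (A)] -/
theorem conjA_two_115a1_of_oddClassNumber
    (hLim2 : Lim2017.thm35_at_two_fineSelmerDual_moduleFinite_of_classicalMuVanishes_of_le_divisionField_four)
    {β : AlgebraicClosure ℚ} (hβ : aeval β (Cubic.toPoly ⟨1, ((0 : ℤ) : ℚ), ((112 : ℤ) : ℚ), ((-688 : ℤ) : ℚ)⟩) = 0)
    (hh : ¬ 2 ∣ Nat.card (ClassGroup (𝓞 (IntermediateField.adjoin ℚ {β}))))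
    (κ : ZpExtension ℚ 2) (hκ : κ.IsCyclotomic) :
    haveI := SSUnitAnchor.isElliptic_ua115a1
    ∃ (γ : absoluteGaloisGroup ℚ) (D : ((⟨0, 0, 1, 7, -11⟩ : WeierstrassCurve ℤ).baseChange ℚ).FineSelmerDualData κ γ),
      Module.Finite ℤ_[2] (RestrictScalars ℤ_[2] (IwasawaAlgebra 2) D.X) := by
  haveI := SSUnitAnchor.isElliptic_ua115a1
  exact conjA_two_goodSSModel_of_oddClassNumber hLim2 (0) (7) (-11) (by norm_num) (by norm_num) (by norm_num) hβ hh κ hκ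

/-- **`FineMuZeroAt (115a1 ⊗ ℚ) 2` modulo `hLim2` + the displayed bit `2 ∤ #Cl(𝓞 ℚ(β))`** (`β` a root of `X³ + 112X − 688`; census: `h(L_W) = 1`). [cite: Lim2017FineSelmer, §3 Thm. 3.5 and Lemma 3.2] [cite: CoatesSujatha2005, §3 statement (A)] -/
theorem fineMuZeroAt_two_115a1_of_oddClassNumber
    (hLim2 : Lim2017.thm35_at_two_fineSelmerDual_moduleFinite_of_classicalMuVanishes_of_le_divisionField_four)
    {β : AlgebraicClosure ℚ} (hβ : aeval β (Cubic.toPoly ⟨1, ((0 : ℤ) : ℚ), ((112 : ℤ) : ℚ), ((-688 : ℤ) : ℚ)⟩) = 0)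
    (hh : ¬ 2 ∣ Nat.card (ClassGroup (𝓞 (IntermediateField.adjoin ℚ {β})))) :
    haveI := SSUnitAnchor.isElliptic_ua115a1
    Literature.NumberTheory.EllipticCurves.Rank1Residual.FineMuZeroAt ((⟨0, 0, 1, 7, -11⟩ : WeierstrassCurve ℤ).baseChange ℚ) 2 :=
  haveI := SSUnitAnchor.isElliptic_ua115a1
  fineMuZeroAt_two_goodSSModel_of_oddClassNumber hLim2 (0) (7) (-11) (by norm_num) (by norm_num) (by norm_num) hβ hh

/-! ### Row `121d1` = `[0, -1, 1, -40, -221]` (`a₂(E) = 2`; `L_W`: `x³ − x² + x + 1`, `d = −44`, `h = 1`) -/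

/-- `[0,-1,1,-40,-221] ⊗ ℚ` (`121d1`) is an elliptic curve (`256·Δ = disc(X³ − 4X² − 640X − 14128) ≠ 0`). [folklore] -/
theorem isElliptic_121d1 : ((⟨0, -1, 1, -40, -221⟩ : WeierstrassCurve ℤ).baseChange ℚ).IsElliptic :=
  isElliptic_goodSSModel _ _ _ (by simp only [Cubic.discr]; norm_num)

/-- **(A)₂ for `121d1` modulo Lim 2017 Thm. 3.5 (`hLim2`) ALONE — NO displayed datum.** Generator swap: `θ = (145/121) + (5/242)·β + (-1/484)·β²` is a root of `g = X³ − X² + X + 1` (`d = −44`) and `β = (16) + (-22)·θ + (22)·θ²`, so `ℚ(P) = ℚ(β) = ℚ(θ)`; `2 ∤ #Cl(𝓞 ℚ(θ))` BY THE KERNEL (|disc g| = 44 ≤ 45, `…CubicDiscriminant.not_two_dvd_card_classGroup_adjoin_of_abs_discr_le`). Row data (Cremona `allcurves`/`allbsd`): minimal model `[0,-1,1,-40,-221]`, `N = 121`, `a₂(E) = 2` (good supersingular at `2`), `r = 0`, `#tors = 1`, non-CM; `2`-division cubic of `β = 4x(P)`: `X³ − 4X² − 640X − 14128`; Eisenstein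 cubic of `π = 2x(P)`: `Y³ − 2Y² − 160Y − 1766`; `L_W = ℚ(β) ≅ ℚ[x]/(x³ − x² + x + 1)`, complex cubic (Δ_E < 0), `d(L_W) = −44`, `h(L_W) = 1` (kit j343820: polredabs/bnfinit, `bnfcertify = 1`). [cite: Lim2017FineSelmer, §3 Thm. 3.5 and Lemma 3.2] [cite: CoatesSujatha2005, §3 statement (A)] -/
theorem conjA_two_121d1
    (hLim2 : Lim2017.thm35_at_two_fineSelmerDual_moduleFinite_of_classicalMuVanishes_of_le_divisionField_four)
    (κ : ZpExtension ℚ 2) (hκ : κ.IsCyclotomic) :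
    haveI := isElliptic_121d1
    ∃ (γ : absoluteGaloisGroup ℚ) (D : ((⟨0, -1, 1, -40, -221⟩ : WeierstrassCurve ℤ).baseChange ℚ).FineSelmerDualData κ γ),
      Module.Finite ℤ_[2] (RestrictScalars ℤ_[2] (IwasawaAlgebra 2) D.X) := by
  haveI := isElliptic_121d1
  refine conjA_two_goodSSModel_of_generator hLim2 (-1) (-40) (-221) (-1) (1) (1) (145/121) (5/242) (-1/484) (16) (-22) (22)
    (fun β θ hβ hθ ↦ ?_) (fun θ hθ ↦ not_two_dvd_card_classGroup_twoDivField_d44n hθ) κ hκ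
  subst hθ; push_cast at hβ ⊢
  exact ⟨by linear_combination (((-2491 : AlgebraicClosure ℚ) / 14172488) + ((105 : AlgebraicClosure ℚ) / 28344976) * β + ((13 : AlgebraicClosure ℚ) / 56689952) * β ^ 2 + ((-1 : AlgebraicClosure ℚ) / 113379904) * β ^ 3) * hβ,
    by linear_combination (-1 : AlgebraicClosure ℚ) * (((-2 : AlgebraicClosure ℚ) / 1331) + ((1 : AlgebraicClosure ℚ) / 10648) * β) * hβ⟩

/-- **`FineMuZeroAt (121d1 ⊗ ℚ) 2` modulo `hLim2` ALONE** (kernel bit via the `d = −44` generator swap). [cite: Lim2017FineSelmer, §3 Thm. 3.5 and Lemma 3.2] [cite: CoatesSujatha2005, §3 statement (A)] -/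
theorem fineMuZeroAt_two_121d1
    (hLim2 : Lim2017.thm35_at_two_fineSelmerDual_moduleFinite_of_classicalMuVanishes_of_le_divisionField_four) :
    haveI := isElliptic_121d1
    Literature.NumberTheory.EllipticCurves.Rank1Residual.FineMuZeroAt ((⟨0, -1, 1, -40, -221⟩ : WeierstrassCurve ℤ).baseChange ℚ) 2 :=
  haveI := isElliptic_121d1
  Literature.NumberTheory.EllipticCurves.Rank1Residual.ConjAAt.fineMuZeroAt (conjA_two_121d1 hLim2)

/-! ### Row `135b1` = `[0, 0, 1, -27, -115]` (`a₂(E) = 2`; `L_W`: `x³ − 2`, `d = −108`, `h = 1`) -/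

/-- `[0,0,1,-27,-115] ⊗ ℚ` (`135b1`) is an elliptic curve (`256·Δ = disc(X³ − 432X − 7344) ≠ 0`). [folklore] -/
theorem isElliptic_135b1 : ((⟨0, 0, 1, -27, -115⟩ : WeierstrassCurve ℤ).baseChange ℚ).IsElliptic :=
  isElliptic_goodSSModel _ _ _ (by simp only [Cubic.discr]; norm_num)

/-- **(A)₂ for `135b1` modulo Lim 2017 Thm. 3.5 (`hLim2`) ALONE — NO displayed datum.** Generator swap: `θ = (-16/15) + (-1/90)·β + (1/270)·β²` is a root of `g = X³ − 2` (`d = −108`) and `β = (0) + (6)·θ + (12)·θ²`, so `ℚ(P) = ℚ(β) = ℚ(θ)`; `2 ∤ #Cl(𝓞 ℚ(θ))` BY THE KERNEL (Eisenstein, r = −2, |disc g| = 108, `…MinkowskiDoor`). Row data (Cremona `allcurves`/`allbsd`): minimal model `[0,0,1,-27,-115]`, `N = 135`, `a₂(E) = 2` (good supersingular at `2`), `r = 0`, `#tors = 1`, non-CM; `2`-division cubic of `β = 4x(P)`: `X³ − 432X − 7344`; Eisenstein cubic of `π = 2x(P)`: `Y³ − 108Y − 918`; `L_W = ℚ(β)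 ≅ ℚ[x]/(x³ − 2)`, complex cubic (Δ_E < 0), `d(L_W) = −108`, `h(L_W) = 1` (kit j343820: polredabs/bnfinit, `bnfcertify = 1`). [cite: Lim2017FineSelmer, §3 Thm. 3.5 and Lemma 3.2] [cite: CoatesSujatha2005, §3 statement (A)] -/
theorem conjA_two_135b1
    (hLim2 : Lim2017.thm35_at_two_fineSelmerDual_moduleFinite_of_classicalMuVanishes_of_le_divisionField_four)
    (κ : ZpExtension ℚ 2) (hκ : κ.IsCyclotomic) :
    haveI := isElliptic_135b1
    ∃ (γ : absoluteGaloisGroup ℚ) (D : ((⟨0, 0, 1, -27, -115⟩ : WeierstrassCurve ℤ).baseChange ℚ).FineSelmerDualData κ γ),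
      Module.Finite ℤ_[2] (RestrictScalars ℤ_[2] (IwasawaAlgebra 2) D.X) := by
  haveI := isElliptic_135b1
  refine conjA_two_goodSSModel_of_generator hLim2 (0) (-27) (-115) (0) (0) (-2) (-16/15) (-1/90) (1/270) (0) (6) (12)
    (fun β θ hβ hθ ↦ ?_) (fun θ hθ ↦ not_two_dvd_card_classGroup_twoDivField_d108n hθ) κ hκ
  subst hθ; push_cast at hβ ⊢
  exact ⟨by linear_combination (((319 : AlgebraicClosure ℚ) / 729000) + ((-1 : AlgebraicClosure ℚ) / 48600) * β + ((-1 : AlgebraicClosure ℚ) / 2187000) * β ^ 2 + ((1 : AlgebraicClosure ℚ) / 19683000) * β ^ 3) * hβ,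
    by linear_combination (-1 : AlgebraicClosure ℚ) * (((-2 : AlgebraicClosure ℚ) / 2025) + ((1 : AlgebraicClosure ℚ) / 6075) * β) * hβ⟩

/-- **`FineMuZeroAt (135b1 ⊗ ℚ) 2` modulo `hLim2` ALONE** (kernel bit via the `d = −108` generator swap). [cite: Lim2017FineSelmer, §3 Thm. 3.5 and Lemma 3.2] [cite: CoatesSujatha2005, §3 statement (A)] -/
theorem fineMuZeroAt_two_135b1
    (hLim2 : Lim2017.thm35_at_two_fineSelmerDual_moduleFinite_of_classicalMuVanishes_of_le_divisionField_four) :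
    haveI := isElliptic_135b1
    Literature.NumberTheory.EllipticCurves.Rank1Residual.FineMuZeroAt ((⟨0, 0, 1, -27, -115⟩ : WeierstrassCurve ℤ).baseChange ℚ) 2 :=
  haveI := isElliptic_135b1
  Literature.NumberTheory.EllipticCurves.Rank1Residual.ConjAAt.fineMuZeroAt (conjA_two_135b1 hLim2)

/-! ### Row `141e1` = `[0, 1, 1, -26, -61]` (`a₂(E) = 2`; `L_W`: `x³ − x² − 5x + 3`, `d = 564`, `h = 1`) -/

/-- `[0,1,1,-26,-61] ⊗ ℚ` (`141e1`) is an elliptic curve (`256·Δ = disc(X³ + 4X² − 416X − 3888) ≠ 0`). [folklore] -/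
theorem isElliptic_141e1 : ((⟨0, 1, 1, -26, -61⟩ : WeierstrassCurve ℤ).baseChange ℚ).IsElliptic :=
  isElliptic_goodSSModel _ _ _ (by simp only [Cubic.discr]; norm_num)

/-- **(A)₂ for `141e1` modulo Lim 2017 Thm. 3.5 (`hLim2`) + ONE displayed bit `2 ∤ #Cl(𝓞 ℚ(β))`** (census value: `h(L_W) = 1`, `d(L_W) = 564` — PARI, not kernel). Row data (Cremona `allcurves`/`allbsd`): minimal model `[0,1,1,-26,-61]`, `N = 141`, `a₂(E) = 2` (good supersingular at `2`), `r = 0`, `#tors = 1`, non-CM; `2`-division cubic of `β = 4x(P)`: `X³ + 4X² − 416X − 3888`; Eisenstein cubic of `π = 2x(P)`: `Y³ + 2Y² − 104Y − 486`; `L_W = ℚ(β) ≅ ℚ[x]/(x³ − x² − 5x + 3)`, totally real cubic (Δ_E > 0), `d(L_W) = 564`, `h(L_W) = 1` (kit j343820: polredabs/bnfinit, `bnfcertify = 1`). [cite: Lim2017FineSelmer, §3 Thm. 3.5 and Lemma 3.2] [cite: CoatesSujatha2005, §3 statement (A)] -/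
theorem conjA_two_141e1_of_oddClassNumber
    (hLim2 : Lim2017.thm35_at_two_fineSelmerDual_moduleFinite_of_classicalMuVanishes_of_le_divisionField_four)
    {β : AlgebraicClosure ℚ} (hβ : aeval β (Cubic.toPoly ⟨1, ((4 : ℤ) : ℚ), ((-416 : ℤ) : ℚ), ((-3888 : ℤ) : ℚ)⟩) = 0)
    (hh : ¬ 2 ∣ Nat.card (ClassGroup (𝓞 (IntermediateField.adjoin ℚ {β}))))
    (κ : ZpExtension ℚ 2) (hκ : κ.IsCyclotomic) :
    haveI := isElliptic_141e1
    ∃ (γ : absoluteGaloisGroup ℚ) (D : ((⟨0, 1, 1, -26, -61⟩ : WeierstrassCurve ℤ).baseChange ℚ).FineSelmerDualData κ γ),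
      Module.Finite ℤ_[2] (RestrictScalars ℤ_[2] (IwasawaAlgebra 2) D.X) := by
  haveI := isElliptic_141e1
  exact conjA_two_goodSSModel_of_oddClassNumber hLim2 (1) (-26) (-61) (by norm_num) (by norm_num) (by norm_num) hβ hh κ hκ

/-- **`FineMuZeroAt (141e1 ⊗ ℚ) 2` modulo `hLim2` + the displayed bit `2 ∤ #Cl(𝓞 ℚ(β))`** (`β` a root of `X³ + 4X² − 416X − 3888`; census: `h(L_W) = 1`). [cite: Lim2017FineSelmer, §3 Thm. 3.5 and Lemma 3.2] [cite: CoatesSujatha2005, §3 statement (A)] -/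
theorem fineMuZeroAt_two_141e1_of_oddClassNumber
    (hLim2 : Lim2017.thm35_at_two_fineSelmerDual_moduleFinite_of_classicalMuVanishes_of_le_divisionField_four)
    {β : AlgebraicClosure ℚ} (hβ : aeval β (Cubic.toPoly ⟨1, ((4 : ℤ) : ℚ), ((-416 : ℤ) : ℚ), ((-3888 : ℤ) : ℚ)⟩) = 0)
    (hh : ¬ 2 ∣ Nat.card (ClassGroup (𝓞 (IntermediateField.adjoin ℚ {β})))) :
    haveI := isElliptic_141e1
    Literature.NumberTheory.EllipticCurves.Rank1Residual.FineMuZeroAt ((⟨0, 1, 1, -26, -61⟩ : WeierstrassCurve ℤ).baseChange ℚ) 2 :=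
  haveI := isElliptic_141e1
  fineMuZeroAt_two_goodSSModel_of_oddClassNumber hLim2 (1) (-26) (-61) (by norm_num) (by norm_num) (by norm_num) hβ hh

/-! ### Row `147b1` = `[0, 1, 1, -114, 473]` (`a₂(E) = 2`; `L_W`: `x³ − x² + 5x + 1`, `d = −588`, `h = 3`) -/

/-- `[0,1,1,-114,473] ⊗ ℚ` (`147b1`) is an elliptic curve (`256·Δ = disc(X³ + 4X² − 1824X + 30288) ≠ 0`). [folklore] -/
theorem isElliptic_147b1 : ((⟨0, 1, 1, -114, 473⟩ : WeierstrassCurve ℤ).baseChange ℚ).IsElliptic :=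
  isElliptic_goodSSModel _ _ _ (by simp only [Cubic.discr]; norm_num)

/-- **(A)₂ for `147b1` modulo Lim 2017 Thm. 3.5 (`hLim2`) + ONE displayed bit `2 ∤ #Cl(𝓞 ℚ(β))`** (census value: `h(L_W) = 3`, `d(L_W) = −588` — PARI, not kernel). Row data (Cremona `allcurves`/`allbsd`): minimal model `[0,1,1,-114,473]`, `N = 147`, `a₂(E) = 2` (good supersingular at `2`), `r = 0`, `#tors = 1`, non-CM; `2`-division cubic of `β = 4x(P)`: `X³ + 4X² − 1824X + 30288`; Eisenstein cubic of `π = 2x(P)`: `Y³ + 2Y² − 456Y + 3786`; `L_W = ℚ(β) ≅ ℚ[x]/(x³ − x² + 5x + 1)`, complex cubic (Δ_E < 0), `d(L_W) = −588`, `h(L_W) = 3` (`Cl = [3]`) (kit j343820: polredabs/bnfinit, `bnfcertify = 1`). [cite: Lim2017FineSelmer, §3 Thm. 3.5 and Lemma 3.2] [cite: CoatesSujatha2005, §3 statement (A)] -/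
theorem conjA_two_147b1_of_oddClassNumber
    (hLim2 : Lim2017.thm35_at_two_fineSelmerDual_moduleFinite_of_classicalMuVanishes_of_le_divisionField_four)
    {β : AlgebraicClosure ℚ} (hβ : aeval β (Cubic.toPoly ⟨1, ((4 : ℤ) : ℚ), ((-1824 : ℤ) : ℚ), ((30288 : ℤ) : ℚ)⟩) = 0)
    (hh : ¬ 2 ∣ Nat.card (ClassGroup (𝓞 (IntermediateField.adjoin ℚ {β}))))
    (κ : ZpExtension ℚ 2) (hκ : κ.IsCyclotomic) :
    haveI := isElliptic_147b1
    ∃ (γ : absoluteGaloisGroup ℚ) (D : ((⟨0, 1, 1, -114, 473⟩ : WeierstrassCurve ℤ).baseChange ℚ).FineSelmerDualData κ γ),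
      Module.Finite ℤ_[2] (RestrictScalars ℤ_[2] (IwasawaAlgebra 2) D.X) := by
  haveI := isElliptic_147b1
  exact conjA_two_goodSSModel_of_oddClassNumber hLim2 (1) (-114) (473) (by norm_num) (by norm_num) (by norm_num) hβ hh κ hκ

/-- **`FineMuZeroAt (147b1 ⊗ ℚ) 2` modulo `hLim2` + the displayed bit `2 ∤ #Cl(𝓞 ℚ(β))`** (`β` a root of `X³ + 4X² − 1824X + 30288`; census: `h(L_W) = 3`). [cite: Lim2017FineSelmer, §3 Thm. 3.5 and Lemma 3.2] [cite: CoatesSujatha2005, §3 statement (A)] -/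
theorem fineMuZeroAt_two_147b1_of_oddClassNumber
    (hLim2 : Lim2017.thm35_at_two_fineSelmerDual_moduleFinite_of_classicalMuVanishes_of_le_divisionField_four)
    {β : AlgebraicClosure ℚ} (hβ : aeval β (Cubic.toPoly ⟨1, ((4 : ℤ) : ℚ), ((-1824 : ℤ) : ℚ), ((30288 : ℤ) : ℚ)⟩) = 0)
    (hh : ¬ 2 ∣ Nat.card (ClassGroup (𝓞 (IntermediateField.adjoin ℚ {β})))) :
    haveI := isElliptic_147b1
    Literature.NumberTheory.EllipticCurves.Rank1Residual.FineMuZeroAt ((⟨0, 1, 1, -114, 473⟩ : WeierstrassCurve ℤ).baseChange ℚ) 2 :=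
  haveI := isElliptic_147b1
  fineMuZeroAt_two_goodSSModel_of_oddClassNumber hLim2 (1) (-114) (473) (by norm_num) (by norm_num) (by norm_num) hβ hh

/-! ### Row `147c1` = `[0, -1, 1, -2, -1]` (`a₂(E) = 2`; `L_W`: `x³ − x² + 5x + 1`, `d = −588`, `h = 3`) -/

/-- `[0,-1,1,-2,-1] ⊗ ℚ` (`147c1`) is an elliptic curve (`256·Δ = disc(X³ − 4X² − 32X − 48) ≠ 0`). [folklore] -/
theorem isElliptic_147c1 : ((⟨0, -1, 1, -2, -1⟩ : WeierstrassCurve ℤ).baseChange ℚ).IsElliptic :=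
  isElliptic_goodSSModel _ _ _ (by simp only [Cubic.discr]; norm_num)

/-- **(A)₂ for `147c1` modulo Lim 2017 Thm. 3.5 (`hLim2`) + ONE displayed bit `2 ∤ #Cl(𝓞 ℚ(β))`** (census value: `h(L_W) = 3`, `d(L_W) = −588` — PARI, not kernel). Row data (Cremona `allcurves`/`allbsd`): minimal model `[0,-1,1,-2,-1]`, `N = 147`, `a₂(E) = 2` (good supersingular at `2`), `r = 0`, `#tors = 1`, non-CM; `2`-division cubic of `β = 4x(P)`: `X³ − 4X² − 32X − 48`; Eisenstein cubic of `π = 2x(P)`: `Y³ − 2Y² − 8Y − 6`; `L_W = ℚ(β) ≅ ℚ[x]/(x³ − x² + 5x + 1)`, complex cubic (Δ_E < 0), `d(L_W) = −588`, `h(L_W) = 3` (`Cl = [3]`) (kit j343820: polredabs/bnfinit, `bnfcertify = 1`). [cite: Lim2017FineSelmer, §3 Thm. 3.5 and Lemma 3.2] [cite: CoatesSujatha2005, §3 statement (A)] -/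
theorem conjA_two_147c1_of_oddClassNumber
    (hLim2 : Lim2017.thm35_at_two_fineSelmerDual_moduleFinite_of_classicalMuVanishes_of_le_divisionField_four)
    {β : AlgebraicClosure ℚ} (hβ : aeval β (Cubic.toPoly ⟨1, ((-4 : ℤ) : ℚ), ((-32 : ℤ) : ℚ), ((-48 : ℤ) : ℚ)⟩) = 0)
    (hh : ¬ 2 ∣ Nat.card (ClassGroup (𝓞 (IntermediateField.adjoin ℚ {β}))))
    (κ : ZpExtension ℚ 2) (hκ : κ.IsCyclotomic) :
    haveI := isElliptic_147c1
    ∃ (γ : absoluteGaloisGroup ℚ) (D : ((⟨0, -1, 1, -2, -1⟩ : WeierstrassCurve ℤ).baseChange ℚ).FineSelmerDualData κ γ),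
      Module.Finite ℤ_[2] (RestrictScalars ℤ_[2] (IwasawaAlgebra 2) D.X) := by
  haveI := isElliptic_147c1
  exact conjA_two_goodSSModel_of_oddClassNumber hLim2 (-1) (-2) (-1) (by norm_num) (by norm_num) (by norm_num) hβ hh κ hκ

/-- **`FineMuZeroAt (147c1 ⊗ ℚ) 2` modulo `hLim2` + the displayed bit `2 ∤ #Cl(𝓞 ℚ(β))`** (`β` a root of `X³ − 4X² − 32X − 48`; census: `h(L_W) = 3`). [cite: Lim2017FineSelmer, §3 Thm. 3.5 and Lemma 3.2] [cite: CoatesSujatha2005, §3 statement (A)] -/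
theorem fineMuZeroAt_two_147c1_of_oddClassNumber
    (hLim2 : Lim2017.thm35_at_two_fineSelmerDual_moduleFinite_of_classicalMuVanishes_of_le_divisionField_four)
    {β : AlgebraicClosure ℚ} (hβ : aeval β (Cubic.toPoly ⟨1, ((-4 : ℤ) : ℚ), ((-32 : ℤ) : ℚ), ((-48 : ℤ) : ℚ)⟩) = 0)
    (hh : ¬ 2 ∣ Nat.card (ClassGroup (𝓞 (IntermediateField.adjoin ℚ {β})))) :
    haveI := isElliptic_147c1
    Literature.NumberTheory.EllipticCurves.Rank1Residual.FineMuZeroAt ((⟨0, -1, 1, -2, -1⟩ : WeierstrassCurve ℤ).baseChange ℚ) 2 :=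
  haveI := isElliptic_147c1
  fineMuZeroAt_two_goodSSModel_of_oddClassNumber hLim2 (-1) (-2) (-1) (by norm_num) (by norm_num) (by norm_num) hβ hh

/-! ### Row `153d1` = `[0, 0, 1, -27, -61]` (`a₂(E) = 2`; `L_W`: `x³ − x² + x − 3`, `d = −204`, `h = 1`) -/

/-- `[0,0,1,-27,-61] ⊗ ℚ` (`153d1`) is an elliptic curve (`256·Δ = disc(X³ − 432X − 3888) ≠ 0`). [folklore] -/
theorem isElliptic_153d1 : ((⟨0, 0, 1, -27, -61⟩ : WeierstrassCurve ℤ).baseChange ℚ).IsElliptic :=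
  isElliptic_goodSSModel _ _ _ (by simp only [Cubic.discr]; norm_num)

/-- **(A)₂ for `153d1` modulo Lim 2017 Thm. 3.5 (`hLim2`) + ONE displayed bit `2 ∤ #Cl(𝓞 ℚ(β))`** (census value: `h(L_W) = 1`, `d(L_W) = −204` — PARI, not kernel). Row data (Cremona `allcurves`/`allbsd`): minimal model `[0,0,1,-27,-61]`, `N = 153`, `a₂(E) = 2` (good supersingular at `2`), `r = 0`, `#tors = 1`, non-CM; `2`-division cubic of `β = 4x(P)`: `X³ − 432X − 3888`; Eisenstein cubic of `π = 2x(P)`: `Y³ − 108Y − 486`; `L_W = ℚ(β) ≅ ℚ[x]/(x³ − x² + x − 3)`, complex cubic (Δ_E < 0), `d(L_W) = −204`, `h(L_W) = 1` (kit j343820: polredabs/bnfinit, `bnfcertify = 1`). [cite: Lim2017FineSelmer, §3 Thm. 3.5 and Lemma 3.2] [cite: CoatesSujatha2005, §3 statement (A)] -/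
theorem conjA_two_153d1_of_oddClassNumber
    (hLim2 : Lim2017.thm35_at_two_fineSelmerDual_moduleFinite_of_classicalMuVanishes_of_le_divisionField_four)
    {β : AlgebraicClosure ℚ} (hβ : aeval β (Cubic.toPoly ⟨1, ((0 : ℤ) : ℚ), ((-432 : ℤ) : ℚ), ((-3888 : ℤ) : ℚ)⟩) = 0)
    (hh : ¬ 2 ∣ Nat.card (ClassGroup (𝓞 (IntermediateField.adjoin ℚ {β}))))
    (κ : ZpExtension ℚ 2) (hκ : κ.IsCyclotomic) :
    haveI := isElliptic_153d1
    ∃ (γ : absoluteGaloisGroup ℚ) (D : ((⟨0, 0, 1, -27, -61⟩ : WeierstrassCurve ℤ).baseChange ℚ).FineSelmerDualData κ γ),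
      Module.Finite ℤ_[2] (RestrictScalars ℤ_[2] (IwasawaAlgebra 2) D.X) := by
  haveI := isElliptic_153d1
  exact conjA_two_goodSSModel_of_oddClassNumber hLim2 (0) (-27) (-61) (by norm_num) (by norm_num) (by norm_num) hβ hh κ hκ

/-- **`FineMuZeroAt (153d1 ⊗ ℚ) 2` modulo `hLim2` + the displayed bit `2 ∤ #Cl(𝓞 ℚ(β))`** (`β` a root of `X³ − 432X − 3888`; census: `h(L_W) = 1`). [cite: Lim2017FineSelmer, §3 Thm. 3.5 and Lemma 3.2] [cite: CoatesSujatha2005, §3 statement (A)] -/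
theorem fineMuZeroAt_two_153d1_of_oddClassNumber
    (hLim2 : Lim2017.thm35_at_two_fineSelmerDual_moduleFinite_of_classicalMuVanishes_of_le_divisionField_four)
    {β : AlgebraicClosure ℚ} (hβ : aeval β (Cubic.toPoly ⟨1, ((0 : ℤ) : ℚ), ((-432 : ℤ) : ℚ), ((-3888 : ℤ) : ℚ)⟩) = 0)
    (hh : ¬ 2 ∣ Nat.card (ClassGroup (𝓞 (IntermediateField.adjoin ℚ {β})))) :
    haveI := isElliptic_153d1
    Literature.NumberTheory.EllipticCurves.Rank1Residual.FineMuZeroAt ((⟨0, 0, 1, -27, -61⟩ : WeierstrassCurve ℤ).baseChange ℚ) 2 :=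
  haveI := isElliptic_153d1
  fineMuZeroAt_two_goodSSModel_of_oddClassNumber hLim2 (0) (-27) (-61) (by norm_num) (by norm_num) (by norm_num) hβ hh

/-! ### Row `171c1` = `[0, 0, 1, 177, 1035]` (`a₂(E) = 2`; `L_W`: `x³ − 2x − 2`, `d = −76`, `h = 1`) -/

/-- `[0,0,1,177,1035] ⊗ ℚ` (`171c1`) is an elliptic curve (`256·Δ = disc(X³ + 2832X + 66256) ≠ 0`). [folklore] -/
theorem isElliptic_171c1 : ((⟨0, 0, 1, 177, 1035⟩ : WeierstrassCurve ℤ).baseChange ℚ).IsElliptic :=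
  isElliptic_goodSSModel _ _ _ (by simp only [Cubic.discr]; norm_num)

/-- **(A)₂ for `171c1` modulo Lim 2017 Thm. 3.5 (`hLim2`) ALONE — NO displayed datum.** Generator swap: `θ = (2360/2187) + (-97/4374)·β + (5/8748)·β²` is a root of `g = X³ − 2X − 2` (`d = −76`) and `β = (-40) + (-42)·θ + (30)·θ²`, so `ℚ(P) = ℚ(β) = ℚ(θ)`; `2 ∤ #Cl(𝓞 ℚ(θ))` BY THE KERNEL (Eisenstein, r = −2, |disc g| = 76 ≤ 108, `…MinkowskiDoor.card_classGroup_adjoin_eq_one_of_eisenstein_two_of_abs_discr_le`). Row data (Cremona `allcurves`/`allbsd`): minimal model `[0,0,1,177,1035]`, `N = 171`, `a₂(E) = 2` (good supersingular at `2`), `r = 0`, `#tors = 1`, non-CM; `2`-division cubic of `β = 4x(P)`: `X³ + 2832X + 66256`; Eisenstein cubic of `π = 2x(P)`: `Y³ + 708Y + 8282`; `L_W = ℚ(β) ≅ ℚ[x]/(x³ − 2x − 2)`, complex cubic (Δ_E < 0), `d(L_W) = −76`, `h(L_W) = 1` (kit j343820: polredabs/bnfinit, `bnfcertify = 1`). [cite: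 Lim2017FineSelmer, §3 Thm. 3.5 and Lemma 3.2] [cite: CoatesSujatha2005, §3 statement (A)] -/
theorem conjA_two_171c1
    (hLim2 : Lim2017.thm35_at_two_fineSelmerDual_moduleFinite_of_classicalMuVanishes_of_le_divisionField_four)
    (κ : ZpExtension ℚ 2) (hκ : κ.IsCyclotomic) :
    haveI := isElliptic_171c1
    ∃ (γ : absoluteGaloisGroup ℚ) (D : ((⟨0, 0, 1, 177, 1035⟩ : WeierstrassCurve ℤ).baseChange ℚ).FineSelmerDualData κ γ),
      Module.Finite ℤ_[2] (RestrictScalars ℤ_[2] (IwasawaAlgebra 2) D.X) := by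
  haveI := isElliptic_171c1
  refine conjA_two_goodSSModel_of_generator hLim2 (0) (177) (1035) (0) (-2) (-2) (2360/2187) (-97/4374) (5/8748) (-40) (-42) (30)
    (fun β θ hβ hθ ↦ ?_) (fun θ hθ ↦ not_two_dvd_card_classGroup_twoDivField_d76n hθ) κ hκ
  subst hθ; push_cast at hβ ⊢
  exact ⟨by linear_combination (((-3664823 : AlgebraicClosure ℚ) / 83682825624) + ((35 : AlgebraicClosure ℚ) / 25509168) * β + ((-2425 : AlgebraicClosure ℚ) / 111577100832) * β ^ 2 + ((125 : AlgebraicClosure ℚ) / 669462604992) * β ^ 3) * hβ,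
    by linear_combination (-1 : AlgebraicClosure ℚ) * (((-2425 : AlgebraicClosure ℚ) / 3188646) + ((125 : AlgebraicClosure ℚ) / 12754584) * β) * hβ⟩

/-- **`FineMuZeroAt (171c1 ⊗ ℚ) 2` modulo `hLim2` ALONE** (kernel bit via the `d = −76` generator swap). [cite: Lim2017FineSelmer, §3 Thm. 3.5 and Lemma 3.2] [cite: CoatesSujatha2005, §3 statement (A)] -/
theorem fineMuZeroAt_two_171c1
    (hLim2 : Lim2017.thm35_at_two_fineSelmerDual_moduleFinite_of_classicalMuVanishes_of_le_divisionField_four) :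
    haveI := isElliptic_171c1
    Literature.NumberTheory.EllipticCurves.Rank1Residual.FineMuZeroAt ((⟨0, 0, 1, 177, 1035⟩ : WeierstrassCurve ℤ).baseChange ℚ) 2 :=
  haveI := isElliptic_171c1
  Literature.NumberTheory.EllipticCurves.Rank1Residual.ConjAAt.fineMuZeroAt (conjA_two_171c1 hLim2)

/-! ### Row `171d1` = `[0, 0, 1, -21, -41]` (`a₂(E) = 2`; `L_W`: `x³ − 2x − 2`, `d = −76`, `h = 1`) -/

/-- `[0,0,1,-21,-41] ⊗ ℚ` (`171d1`) is an elliptic curve (`256·Δ = disc(X³ − 336X − 2608) ≠ 0`). [folklore] -/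
theorem isElliptic_171d1 : ((⟨0, 0, 1, -21, -41⟩ : WeierstrassCurve ℤ).baseChange ℚ).IsElliptic :=
  isElliptic_goodSSModel _ _ _ (by simp only [Cubic.discr]; norm_num)

/-- **(A)₂ for `171d1` modulo Lim 2017 Thm. 3.5 (`hLim2`) ALONE — NO displayed datum.** Generator swap: `θ = (-56/27) + (-1/54)·β + (1/108)·β²` is a root of `g = X³ − 2X − 2` (`d = −76`) and `β = (-8) + (6)·θ + (6)·θ²`, so `ℚ(P) = ℚ(β) = ℚ(θ)`; `2 ∤ #Cl(𝓞 ℚ(θ))` BY THE KERNEL (Eisenstein, r = −2, |disc g| = 76 ≤ 108, `…MinkowskiDoor.card_classGroup_adjoin_eq_one_of_eisenstein_two_of_abs_discr_le`). Row data (Cremona `allcurves`/`allbsd`): minimal model `[0,0,1,-21,-41]`, `N = 171`, `a₂(E) = 2` (good supersingular at `2`), `r = 0`, `#tors = 1`, non-CM; `2`-division cubic of `β = 4x(P)`: `X³ − 336X − 2608`; Eisenstein cubic of `π = 2x(P)`: `Y³ − 84Y − 326`; `L_W = ℚ(β) ≅ ℚ[x]/(x³ − 2x − 2)`, complex cubic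 (Δ_E < 0), `d(L_W) = −76`, `h(L_W) = 1` (kit j343820: polredabs/bnfinit, `bnfcertify = 1`). [cite: Lim2017FineSelmer, §3 Thm. 3.5 and Lemma 3.2] [cite: CoatesSujatha2005, §3 statement (A)] -/
theorem conjA_two_171d1
    (hLim2 : Lim2017.thm35_at_two_fineSelmerDual_moduleFinite_of_classicalMuVanishes_of_le_divisionField_four)
    (κ : ZpExtension ℚ 2) (hκ : κ.IsCyclotomic) :
    haveI := isElliptic_171d1
    ∃ (γ : absoluteGaloisGroup ℚ) (D : ((⟨0, 0, 1, -21, -41⟩ : WeierstrassCurve ℤ).baseChange ℚ).FineSelmerDualData κ γ),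
      Module.Finite ℤ_[2] (RestrictScalars ℤ_[2] (IwasawaAlgebra 2) D.X) := by
  haveI := isElliptic_171d1
  refine conjA_two_goodSSModel_of_generator hLim2 (0) (-21) (-41) (0) (-2) (-2) (-56/27) (-1/54) (1/108) (-8) (6) (6)
    (fun β θ hβ hθ ↦ ?_) (fun θ hθ ↦ not_two_dvd_card_classGroup_twoDivField_d76n hθ) κ hκ
  subst hθ; push_cast at hβ ⊢
  exact ⟨by linear_combination (((409 : AlgebraicClosure ℚ) / 157464) + ((-1 : AlgebraicClosure ℚ) / 3888) * β + ((-1 : AlgebraicClosure ℚ) / 209952) * β ^ 2 + ((1 : AlgebraicClosure ℚ) / 1259712) * β ^ 3) * hβ,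
    by linear_combination (-1 : AlgebraicClosure ℚ) * (((-1 : AlgebraicClosure ℚ) / 486) + ((1 : AlgebraicClosure ℚ) / 1944) * β) * hβ⟩

/-- **`FineMuZeroAt (171d1 ⊗ ℚ) 2` modulo `hLim2` ALONE** (kernel bit via the `d = −76` generator swap). [cite: Lim2017FineSelmer, §3 Thm. 3.5 and Lemma 3.2] [cite: CoatesSujatha2005, §3 statement (A)] -/
theorem fineMuZeroAt_two_171d1
    (hLim2 : Lim2017.thm35_at_two_fineSelmerDual_moduleFinite_of_classicalMuVanishes_of_le_divisionField_four) :
    haveI := isElliptic_171d1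
    Literature.NumberTheory.EllipticCurves.Rank1Residual.FineMuZeroAt ((⟨0, 0, 1, -21, -41⟩ : WeierstrassCurve ℤ).baseChange ℚ) 2 :=
  haveI := isElliptic_171d1
  Literature.NumberTheory.EllipticCurves.Rank1Residual.ConjAAt.fineMuZeroAt (conjA_two_171d1 hLim2)

end Summit.BirchSwinnertonDyer.BirchSwinnertonDyer.Theorems.AddKatoTwo

end
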